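import Summits.BirchSwinnertonDyer.Rank1Residual.GaloisImage.KolyvaginDerivativeClasses
import Summits.BirchSwinnertonDyer.Rank1Residual.GaloisImage.KolyvaginAugmentationSquare
import Summits.BirchSwinnertonDyer.Rank1Residual.GaloisImage.KolyvaginTransferCocycle

/-!
# Local coboundary values and words in the conjugation operators — file 3a of row T-DER-TR
# (THEOREM D-tr of T-DER; cell `b2b-bsdres`, team n1011, seat p15 GEN 8, OWNERS row T-DER-TR =
# skel/T-DER-TR.md)

HONEST FRAMING (cell `b2b-bsdres`, run/shared/lean/b2b/bsd-rank1-residual/, verbatim in every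
file): the goal of the cell is to DELETE the COMBINATION-SHAPED residual classes of the
Birch–Swinnerton-Dyer formula for ALL analytic-rank `≤ 1` elliptic curves over `ℚ` — "full BSD
formula for every rank `≤ 1` curve in class `C`" assembled STRICTLY from published theorems — so
that the rank-`≤ 1` remainder becomes exactly the CONSTRUCTION-SHAPED classes, which are TYPED
(missing-input `Prop`s), NOT attempted. This is not "finishing BSD". Team n1011: research route on
the CONSTRUCTION-SHAPED class X4 / §I N11 (route-1 PORT, (P-DER)); TOOL theorems of continuous
group cohomology (no definition, no named fact, no `sorry`); curve-free, `p`-free.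

## What (the two generic inputs of file 3 `KolyvaginTransverseClasses`)

* §1 LOCAL VALUES: for a set `𝒢 ⊆ U` of marked elements invariant under conjugation by `G` (the
  Frobenius powers `φ^f ∈ U_n` of the primes above `q`, with all their conjugates), the classes of
  `H¹(U, X)` EVERY representative of which takes a coboundary value `g·w − w` at every `g ∈ 𝒢` form a
  `conj`-stable subset: `exists_apply_eq_rho_sub_of_oneCocycleClass_eq` (rep-independence of "the
  value at `g` lies in `(g − 1)X`", G1 `exists_forall_apply_eq_add_of_oneCocycleClass_eq`),
  `forall_apply_eq_rho_sub_conjMap` (`(h·φ)(g) = h·φ(h⁻¹gh) = g·(hw) − hw`).  This pointwise currency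
  is that of p11's Kolyvagin congruence (C0d/E2: `x′(φ^f) − Z x(φ^f) ∈ (φ^f − 1)T`) and of the tree's
  local vanishing criterion `FSComp.oneCocycleClass_eq_zero_of_apply_frob_eq`.
* §2 WORDS: `conjMap_mem_closure_of_mem_closure` — for `w` in the subgroup generated by the `σ_ℓ`
  (`ℓ ∈ s`), `conj(w)` on `H¹(U, T)` lies in the submonoid of `End_A H¹(U, T)` generated by the
  `E_ℓ = conj(σ_ℓ)` (`ℓ ∈ s`) (inverses are positive powers since `σ_ℓ^{N_ℓ} ∈ U`);
  `conjMap_mem_closure_of_inv_mul_mem` — hence `conj(g)` is such a word whenever `w⁻¹ g ∈ U` (with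
  F3a `exists_mem_closure_inv_mul_mem`: every `g ∈ Γ_K` at `s = n`, every `g ∈ tameLevel q` at
  `s = n ∖ q`) — the word hypotheses `hFw` / `hG` of file 1 `KolyvaginAugmentationSquare`.
* `aeval_apply_mem_of_forall_mem` — a polynomial in an operator preserving a submodule preserves it.

References: B. Mazur, K. Rubin, *Kolyvagin systems*, Mem. AMS 799 (2004), App. A pp. 83–86;
J.-P. Serre, *Galois Cohomology*, I §5.
-/

noncomputable section

open CategoryTheory Function Finset Polynomial Field IsDedekindDomain
open scoped NumberField Classical
open Literature.NumberTheory.GaloisRepresentations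
open Literature.NumberTheory.EllipticCurves (subgroupInclusion subgroupConj subgroupConj_apply_coe)

universe u v w

namespace Summit.BirchSwinnertonDyer.Rank1Residual.GaloisImage

namespace Derivative

namespace Transverse

/-! ### §1 The local-value submodule: classes whose values at the marked elements are
coboundary values -/

section LocalValues

variable {R : Type u} [CommRing R] [TopologicalSpace R]
variable {G : Type v} [Group G] [TopologicalSpace G] [IsTopologicalGroup G]
variable (X : TopRep.{v} R G) (U : Subgroup G)

/-- **Rep-independence.**  If ONE representative of a class `y ∈ H¹(U, X)` takes a coboundary
value `u·w − w` at `u ∈ U`, then EVERY representative does (representatives differ by a coboundary,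
G1 `exists_forall_apply_eq_add_of_oneCocycleClass_eq`). [folklore] -/
theorem exists_apply_eq_rho_sub_of_oneCocycleClass_eq (u : U) {φ ψ : contOneCocycles (subgroupRep X U)}
    (h : oneCocycleClass _ φ = oneCocycleClass _ ψ) {w : X} (hw : ψ.1 u = X.ρ (u : G) w - w) :
    ∃ w' : X, φ.1 u = X.ρ (u : G) w' - w' := by
  obtain ⟨e, he⟩ := Congruence.exists_forall_apply_eq_add_of_oneCocycleClass_eq X φ ψ h
  refine ⟨w + e, ?_⟩
  rw [he u, hw, map_add]
  abel

variable [U.Normal]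

/-- **Conjugation preserves coboundary values at a conjugation-invariant set of marked elements.**
If `𝒢 ⊆ U` is invariant under conjugation by `G` and every representative of `y ∈ H¹(U, X)` takes a
coboundary value at every `g ∈ 𝒢`, then so does every representative of `conj(h) y`
(`(h·φ)(g) = h·φ(h⁻¹gh) = g·(h w) − h w`). [folklore] -/
theorem forall_apply_eq_rho_sub_conjMap (𝒢 : Set G) (h𝒢U : ∀ g ∈ 𝒢, g ∈ U)
    (h𝒢 : ∀ g ∈ 𝒢, ∀ h : G, h⁻¹ * g * h ∈ 𝒢) (h : G)
    (y : continuousCohomology 1 (subgroupRep X U))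
    (hy : ∀ g (hg : g ∈ 𝒢), ∀ φ : contOneCocycles (subgroupRep X U), oneCocycleClass _ φ = y →
      ∃ w : X, φ.1 ⟨g, h𝒢U g hg⟩ = X.ρ g w - w) :
    ∀ g (hg : g ∈ 𝒢), ∀ φ : contOneCocycles (subgroupRep X U),
      oneCocycleClass _ φ = conjMap X U h 1 y → ∃ w : X, φ.1 ⟨g, h𝒢U g hg⟩ = X.ρ g w - w := by
  intro g hg φ hφ
  obtain ⟨ψ, rfl⟩ := oneCocycleClass_surjective _ y
  rw [conjMap_oneCocycleClass] at hφ
  have hg' : h⁻¹ * g * h ∈ 𝒢 := h𝒢 g hg h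
  obtain ⟨w, hw⟩ := hy _ hg' ψ rfl
  refine exists_apply_eq_rho_sub_of_oneCocycleClass_eq X U ⟨g, h𝒢U g hg⟩ hφ (w := X.ρ h w) ?_
  have hconj : subgroupConj U h ⟨g, h𝒢U g hg⟩ = ⟨h⁻¹ * g * h, h𝒢U _ hg'⟩ :=
    Subtype.ext (by rw [subgroupConj_apply_coe])
  rw [conj_pullback_apply, hconj, hw, map_sub, ← ρ_mul_apply,
    show h * (h⁻¹ * g * h) = g * h by group, ρ_mul_apply]

end LocalValues

/-! ### §2 Words: `conj(g)` is a word in the `E_ℓ` -/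

section Words

variable {K : Type u} [Field K]
variable {A : Type v} [CommRing A] [TopologicalSpace A]
variable {M : Type u} [AddCommGroup M] [Module A M] [TopologicalSpace M] [IsTopologicalAddGroup M]
  [ContinuousSMul A M]
variable (T : GaloisRep K A M)

/-- For `w` in the subgroup of `Γ_K` generated by the `σ_ℓ` (`ℓ ∈ s`), `conj(w)` on `H¹(U, T)` (`U`
normal, with every `σ_ℓ^{N_ℓ} ∈ U`, `N_ℓ ≥ 1`) lies in the submonoid of `End_A H¹(U, T)`
generated by the `E_ℓ = conj(σ_ℓ)`, `ℓ ∈ s` — and so does `conj(w⁻¹)` (inverses are positive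
powers: `conj(σ_ℓ⁻¹) = E_ℓ^{N_ℓ − 1}`). [folklore] -/
theorem conjMap_mem_closure_of_mem_closure (U : Subgroup (absoluteGaloisGroup K)) [U.Normal]
    (σ : HeightOneSpectrum (𝓞 K) → absoluteGaloisGroup K) (N : HeightOneSpectrum (𝓞 K) → ℕ)
    (s : Finset (HeightOneSpectrum (𝓞 K))) (hN : ∀ ℓ ∈ s, σ ℓ ^ N ℓ ∈ U) (hN1 : ∀ ℓ ∈ s, 1 ≤ N ℓ)
    {w : absoluteGaloisGroup K}
    (hw : w ∈ Subgroup.closure (σ '' (s : Set (HeightOneSpectrum (𝓞 K))))) :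
    (conjMap T.toTopRep U w 1).hom.toLinearMap ∈ Submonoid.closure
        ((fun ℓ => (conjMap T.toTopRep U (σ ℓ) 1).hom.toLinearMap) '' (s : Set (HeightOneSpectrum (𝓞 K)))) ∧
      (conjMap T.toTopRep U w⁻¹ 1).hom.toLinearMap ∈ Submonoid.closure
        ((fun ℓ => (conjMap T.toTopRep U (σ ℓ) 1).hom.toLinearMap) '' (s : Set (HeightOneSpectrum (𝓞 K)))) := by
  set C := Submonoid.closure
    ((fun ℓ => (conjMap T.toTopRep U (σ ℓ) 1).hom.toLinearMap) '' (s : Set (HeightOneSpectrum (𝓞 K))))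
    with hC
  -- multiplicativity of `g ↦ conj(g)` as linear endomorphisms
  have hmul : ∀ a b : absoluteGaloisGroup K, (conjMap T.toTopRep U (a * b) 1).hom.toLinearMap =
      (conjMap T.toTopRep U a 1).hom.toLinearMap * (conjMap T.toTopRep U b 1).hom.toLinearMap := by
    intro a b
    refine LinearMap.ext fun y => ?_
    change conjMap T.toTopRep U (a * b) 1 y = conjMap T.toTopRep U a 1 (conjMap T.toTopRep U b 1 y)
    rw [conjMap_conjMap]
  have hone : (conjMap T.toTopRep U (1 : absoluteGaloisGroup K) 1).hom.toLinearMap = 1 := by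
    refine LinearMap.ext fun y => ?_
    change conjMap T.toTopRep U 1 1 y = y
    exact conjMap_one_one _ _ y
  -- generators and their inverses
  have hgen : ∀ ℓ ∈ s, (conjMap T.toTopRep U (σ ℓ) 1).hom.toLinearMap ∈ C := fun ℓ hℓ =>
    Submonoid.subset_closure ⟨ℓ, Finset.mem_coe.mpr hℓ, rfl⟩
  have hinv : ∀ ℓ ∈ s, (conjMap T.toTopRep U (σ ℓ)⁻¹ 1).hom.toLinearMap ∈ C := by
    intro ℓ hℓ
    -- `conj(σ⁻¹) = conj(σ^{N-1})` since `σ^N ∈ U`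
    have hmem : (σ ℓ ^ (N ℓ - 1))⁻¹ * (σ ℓ)⁻¹ ∈ U := by
      rw [← mul_inv_rev, ← pow_succ', Nat.sub_add_cancel (hN1 ℓ hℓ)]
      exact U.inv_mem (hN ℓ hℓ)
    have heq : (conjMap T.toTopRep U (σ ℓ)⁻¹ 1).hom.toLinearMap =
        (conjMap T.toTopRep U (σ ℓ ^ (N ℓ - 1)) 1).hom.toLinearMap := by
      refine LinearMap.ext fun y => ?_
      change conjMap T.toTopRep U (σ ℓ)⁻¹ 1 y = conjMap T.toTopRep U (σ ℓ ^ (N ℓ - 1)) 1 y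
      exact conjMap_eq_conjMap_of_inv_mul_mem T.toTopRep hmem y
    rw [heq]
    have hpow : (conjMap T.toTopRep U (σ ℓ ^ (N ℓ - 1)) 1).hom.toLinearMap =
        (conjMap T.toTopRep U (σ ℓ) 1).hom.toLinearMap ^ (N ℓ - 1) := by
      refine LinearMap.ext fun y => ?_
      exact (conjMap_hom_pow_apply T.toTopRep (σ ℓ) (N ℓ - 1) y).symm
    rw [hpow]
    exact pow_mem (hgen ℓ hℓ) _
  induction hw using Subgroup.closure_induction with
  | mem x hx =>
    obtain ⟨ℓ, hℓ, rfl⟩ := hx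
    exact ⟨hgen ℓ (Finset.mem_coe.mp hℓ), hinv ℓ (Finset.mem_coe.mp hℓ)⟩
  | one =>
    rw [inv_one, hone]
    exact ⟨C.one_mem, C.one_mem⟩
  | mul a b _ _ iha ihb =>
    refine ⟨?_, ?_⟩
    · rw [hmul]; exact C.mul_mem iha.1 ihb.1
    · rw [mul_inv_rev, hmul]; exact C.mul_mem ihb.2 iha.2
  | inv a _ iha =>
    rw [inv_inv]
    exact ⟨iha.2, iha.1⟩

/-- **`conj(g)` is a word in the `E_ℓ`, `ℓ ∈ s`, whenever `g ≡ w (mod U)` for some `w` in the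
subgroup generated by the `σ_ℓ`, `ℓ ∈ s`.**  With F3a's `exists_mem_closure_inv_mul_mem` (the
`σ_ℓ` represent `Γ_K` modulo the tame levels) this applies to every `g ∈ Γ_K` at `s = n`
(`U = level ⊥ n`) and to every `g ∈ tameLevel q` at `s = n ∖ q`. [folklore] -/
theorem conjMap_mem_closure_of_inv_mul_mem (U : Subgroup (absoluteGaloisGroup K)) [U.Normal]
    (σ : HeightOneSpectrum (𝓞 K) → absoluteGaloisGroup K) (N : HeightOneSpectrum (𝓞 K) → ℕ)
    (s : Finset (HeightOneSpectrum (𝓞 K))) (hN : ∀ ℓ ∈ s, σ ℓ ^ N ℓ ∈ U) (hN1 : ∀ ℓ ∈ s, 1 ≤ N ℓ)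
    {w g : absoluteGaloisGroup K}
    (hw : w ∈ Subgroup.closure (σ '' (s : Set (HeightOneSpectrum (𝓞 K))))) (hwg : w⁻¹ * g ∈ U) :
    (conjMap T.toTopRep U g 1).hom.toLinearMap ∈ Submonoid.closure
      ((fun ℓ => (conjMap T.toTopRep U (σ ℓ) 1).hom.toLinearMap) '' (s : Set (HeightOneSpectrum (𝓞 K)))) := by
  have heq : (conjMap T.toTopRep U g 1).hom.toLinearMap = (conjMap T.toTopRep U w 1).hom.toLinearMap := by
    refine LinearMap.ext fun y => ?_
    exact conjMap_eq_conjMap_of_inv_mul_mem T.toTopRep hwg y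
  rw [heq]
  exact (conjMap_mem_closure_of_mem_closure T U σ N s hN hN1 hw).1

end Words
/-! ### §3 Polynomials in an operator -/

section Poly

variable {A : Type v} [CommRing A]

/-- A polynomial in an operator preserving a submodule preserves it. [folklore] -/
theorem aeval_apply_mem_of_forall_mem {X : Type*} [AddCommGroup X] [Module A X] (F : Module.End A X)
    (P : A[X]) (S : Submodule A X) (hS : ∀ y ∈ S, F y ∈ S) {y : X} (hy : y ∈ S) :
    aeval F P y ∈ S := by
  have hpow : ∀ i : ℕ, ∀ y ∈ S, (F ^ i) y ∈ S := fun i => by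
    induction i with
    | zero => intro y hy; simpa using hy
    | succ i ih => intro y hy; rw [pow_succ, Module.End.mul_apply]; exact ih _ (hS y hy)
  rw [aeval_eq_sum_range, LinearMap.sum_apply]
  refine S.sum_mem fun i _ => ?_
  rw [LinearMap.smul_apply]
  exact S.smul_mem _ (hpow i y hy)

end Poly



end Transverse

end Derivative

end Summit.BirchSwinnertonDyer.Rank1Residual.GaloisImage

end
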